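import Summits.Ventures.CertifiedManyBodySolver.HubbardAlg.GSTermwiseRows

/-!
# GSTermwisePlacement — the placement hypothesis of `GSTermwiseRows` as a finite check, and l2's canonical
`2×2 ⊂ 3×3` instance (hubbard-alg L2, R2-TW follow-up part)

HONEST FRAMING: ladder R1–R4 with certified numbers; no claim on H/H₀; bounds for model classes, no materials
claim.  (hubbard-alg: first certified bounds; not a superconductivity verdict; every number certified or labelled
float — this file has NO number.)

`GSTermwiseRows` (#237.1) states its term-wise rows under the placement hypothesis
`∀ X ⊆ thicken B 1, ¬ Disjoint X B → Φ X ≠ 0 → shiftSet (g X) (B ∪ X) ⊆ W`.  Here: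

* `placement_of_sites_bonds`: a term with `Φ X ≠ 0` is a site `{x}` or a bond `{x, x + e_i}`
  (`hubbardFermionInteraction_apply_eq_zero`), and one meeting `B` has `x ∈ B` (site), or `x ∈ B` or
  `x + e_i ∈ B` (bond); so it suffices to place, for every `x ∈ B` and `i : Fin 2`, the site term on `B ∪ {x}`,
  the bond `{x, x + e_i}` on `B ∪ {x, x + e_i}` and the bond `{x - e_i, x}` on `B ∪ {x - e_i, x}` — three
  bounded families over `B × Fin 2` that the kernel settles by `decide` for concrete `B`, `W`, `g`;
* the canonical instance of l2's toy V1 (`hubbard-alg/L2-cluster/runs/idea1-toyV1-eom2x3/`, README §3):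
  `sq2 = {0,1}² ⊂ sq3 = {0,1,2}²`, placement `shiftIntoSq3` (`+1` in every coordinate where a site of the term
  sits at `-1` = "shift `-min` per generator group" for this box), `placement_sq2_sq3` (by `decide`), and the
  instantiated rows `gsObsNode_twStability_sq2_sq3` (E2-type, words commuting with the local `N`, `S^z`) and
  `gsObsNode_twStationarity_sq2_sq3` (E1-type, every word);
* the symmetry obligations of the E2 rows from ONE structural predicate: a word `A` that is block diagonal in
  the `(N↑, N↓)` sectors (`PreservesSectors A`, closed under `+`, `•`, `*`, `∑`, with the letters
  `LiebThm1.preservesSectors_hopping x y σ : PreservesSectors (c†_{xσ} c_{yσ})` and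
  `LiebThm1.preservesSectors_numberOp x σ` in the tree) commutes with the local `N` and `S^z`
  (`commute_totalNumber_of_preservesSectors`, `commute_spinZ_of_preservesSectors`, via
  `PreservesSectors.commute_diagonal` and `LiebThm1.totalNumber_eq_diagonal` / `LiebThm1.spinZ_eq_diagonal`);
  hence `gsObsNode_twStability_of_preservesSectors` and the instance `gsObsNode_twStability_sq2_sq3'`.

References: [cite: BratteliRobinsonII1997, Prop. 5.3.25 + Thm. 6.2.4]; [cite: KullEtAl2024, §II.B];
[cite: LiebPRL1989, Remark (2)] (`H`, and every spin-diagonal hopping / density word, is block diagonal in `(N↑, N↓)`).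
Cell records: pub-hubbard `lean/README.md` § LEAN FILING REQUEST #237 (part .2), `pub-hubbard-bounds/r2tw/`.
-/

noncomputable section

namespace Summit.Ventures.CertifiedManyBodySolver.HubbardAlg.GSTermwisePlacement

open Finset
open Literature.Probability.LatticeModels
open Literature.MathematicalPhysics.QuantumLattice
open Literature.MathematicalPhysics.QuantumLattice.HubbardWave0
open Summit.Ventures.CertifiedManyBodySolver.HubbardAlg.GSWindowNodeD4
open Summit.Ventures.CertifiedManyBodySolver.HubbardAlg.GSTermwiseRows

variable (t U : ℝ)

/-- **The placement hypothesis is a finite check over the sites and bonds of `B`.**  A term with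
`Φ X ≠ 0` is a site `{x}` or a bond `{x, x + e_i}` (`hubbardFermionInteraction_apply_eq_zero`), and one meeting `B`
has `x ∈ B` (site), or `x ∈ B` or `x + e_i ∈ B` (bond); so it suffices to place, for every `x ∈ B` and `i`, the
site term on `B ∪ {x}`, the bond `{x, x + e_i}` on `B ∪ {x, x + e_i}` and the bond `{x - e_i, x}` on
`B ∪ {x - e_i, x}` — three bounded families that `decide` settles for concrete `B`, `W`, `g`. -/
theorem placement_of_sites_bonds {W B : Finset (Site 2)} {g : Finset (Site 2) → Site 2}
    (h1 : ∀ x ∈ B, shiftSet (g {x}) (B ∪ {x}) ⊆ W)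
    (h2 : ∀ x ∈ B, ∀ i : Fin 2, shiftSet (g {x, x + unitVec i}) (B ∪ {x, x + unitVec i}) ⊆ W)
    (h3 : ∀ x ∈ B, ∀ i : Fin 2, shiftSet (g {x - unitVec i, x}) (B ∪ {x - unitVec i, x}) ⊆ W) :
    ∀ X ⊆ thicken B 1, ¬ Disjoint X B →
      (hubbardFermionInteraction 2 t U).Φ X ≠ 0 → shiftSet (g X) (B ∪ X) ⊆ W := by
  intro X _ hd hΦ
  by_cases hs : ∃ x, X = {x}
  · obtain ⟨x, rfl⟩ := hs
    rw [Finset.disjoint_singleton_left, not_not] at hd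
    exact h1 x hd
  by_cases hb : ∃ (x : Site 2) (i : Fin 2), X = {x, x + unitVec i}
  · obtain ⟨x, i, rfl⟩ := hb
    rw [Finset.disjoint_insert_left, Finset.disjoint_singleton_left, not_and_or, not_not, not_not] at hd
    rcases hd with hx | hx
    · exact h2 x hx i
    · simpa only [add_sub_cancel_right] using h3 _ hx i
  · exact absurd (hubbardFermionInteraction_apply_eq_zero (t := t) (U := U)
      (fun x h => hs ⟨x, h⟩) (fun x i h => hb ⟨x, i, h⟩)) hΦ

/-! ### The canonical instance (l2 toy V1): `2×2` words in the `3×3` window -/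

/-- The `2×2` word box `{0,1}²`. -/
def sq2 : Finset (Site 2) := {![0, 0], ![0, 1], ![1, 0], ![1, 1]}

/-- The `3×3` window `{0,1,2}²`. -/
def sq3 : Finset (Site 2) :=
  {![0, 0], ![0, 1], ![0, 2], ![1, 0], ![1, 1], ![1, 2], ![2, 0], ![2, 1], ![2, 2]}

/-- l2's placement for `sq2 ⊂ sq3`: `+1` in every coordinate where a site of the term sits at `-1`. -/
def shiftIntoSq3 (X : Finset (Site 2)) : Site 2 :=
  ![if ∃ y ∈ X, y 0 = -1 then 1 else 0, if ∃ y ∈ X, y 1 = -1 then 1 else 0]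

/-- **Every term of `H_{sq2⁺}` meeting `sq2` places into `sq3`** (kernel `decide` on the three bounded families). -/
theorem placement_sq2_sq3 :
    ∀ X ⊆ thicken sq2 1, ¬ Disjoint X sq2 →
      (hubbardFermionInteraction 2 t U).Φ X ≠ 0 → shiftSet (shiftIntoSq3 X) (sq2 ∪ X) ⊆ sq3 :=
  placement_of_sites_bonds t U (by decide) (by decide) (by decide)

/-- **l2 toy V1, certified shape (E2)**: for every word `A` on the `2×2` box commuting with the local `N` and
`S^z`, the term-wise relocated stability observable in the `3×3` window is a floor-`0` ground-state node. -/
theorem gsObsNode_twStability_sq2_sq3 (n : ℝ) {A : FermionOp sq2} (hAN : Commute A totalNumber)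
    (hAS : Commute A HubbardWave0.spinZ) :
    GSObsNode t U n sq3 (twStabilityObs t U sq3 sq2 A shiftIntoSq3) 0 :=
  gsObsNode_twStability t U n hAN hAS (placement_sq2_sq3 t U)

/-- **l2 toy V1, certified shape (E1)**: the two-sided stationarity rows of every word on the `2×2` box,
relocated term-wise into the `3×3` window. -/
theorem gsObsNode_twStationarity_sq2_sq3 (n : ℝ) (Xw : FermionOp sq2) :
    GSObsNode t U n sq3 (twCommObs t U sq3 sq2 Xw shiftIntoSq3) 0 ∧
      GSObsNode t U n sq3 (-twCommObs t U sq3 sq2 Xw shiftIntoSq3) 0 :=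
  gsObsNode_twStationarity t U n Xw (placement_sq2_sq3 t U)


/-! ## The symmetry obligations `[A, N] = [A, S^z] = 0` from `PreservesSectors A` -/

/-- A word that is block diagonal in the `(N↑, N↓)` sectors commutes with the local particle number.
[cite: LiebPRL1989, Remark (2)] -/
theorem commute_totalNumber_of_preservesSectors {B : Finset (Site 2)} {A : FermionOp B}
    (hA : PreservesSectors A) : Commute A totalNumber := by
  rw [LiebThm1.totalNumber_eq_diagonal]
  exact hA.commute_diagonal fun a b => ((a + b : ℕ) : ℂ)

/-- A word that is block diagonal in the `(N↑, N↓)` sectors commutes with the local `S^z`.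
[cite: LiebPRL1989, Remark (2)] -/
theorem commute_spinZ_of_preservesSectors {B : Finset (Site 2)} {A : FermionOp B}
    (hA : PreservesSectors A) : Commute A HubbardWave0.spinZ := by
  rw [LiebThm1.spinZ_eq_diagonal]
  exact hA.commute_diagonal fun a b => (1 / 2 : ℂ) * ((a : ℂ) - (b : ℂ))

/-- **E2 row from the structural predicate**: `gsObsNode_twStability` for every sector-preserving word `A`
(build `PreservesSectors A` with `PreservesSectors.add/.smul/.mul/.sum` from `LiebThm1.preservesSectors_hopping`,
`LiebThm1.preservesSectors_numberOp`). -/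
theorem gsObsNode_twStability_of_preservesSectors (n : ℝ) {W B : Finset (Site 2)} {A : FermionOp B}
    (hA : PreservesSectors A) {g : Finset (Site 2) → Site 2}
    (hg : ∀ X ⊆ thicken B 1, ¬ Disjoint X B →
      (hubbardFermionInteraction 2 t U).Φ X ≠ 0 → shiftSet (g X) (B ∪ X) ⊆ W) :
    GSObsNode t U n W (twStabilityObs t U W B A g) 0 :=
  gsObsNode_twStability t U n (commute_totalNumber_of_preservesSectors hA)
    (commute_spinZ_of_preservesSectors hA) hg

/-- **l2 toy V1, certified shape (E2), structural form**: for every sector-preserving word `A` on the `2×2`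
box, the term-wise relocated stability observable in the `3×3` window is a floor-`0` ground-state node —
no symmetry and no placement obligation left for the certificate author. -/
theorem gsObsNode_twStability_sq2_sq3' (n : ℝ) {A : FermionOp sq2} (hA : PreservesSectors A) :
    GSObsNode t U n sq3 (twStabilityObs t U sq3 sq2 A shiftIntoSq3) 0 :=
  gsObsNode_twStability_of_preservesSectors t U n hA (placement_sq2_sq3 t U)

/-- Sample discharge (documentation): a scaled spin-summed hopping word plus a density–density word on any box
is sector preserving, by the tree's combinators. -/
example {B : Finset (Site 2)} (x y : PolySite B) (c : ℂ) :
    PreservesSectors ((c • ∑ σ : Fin 2, creation (orb x σ) * annihilation (orb y σ)) +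
      numberOp x 0 * numberOp y 1 : FermionOp B) :=
  PreservesSectors.add (PreservesSectors.smul (PreservesSectors.sum fun σ _ =>
    LiebThm1.preservesSectors_hopping x y σ) _)
    ((LiebThm1.preservesSectors_numberOp x 0).mul (LiebThm1.preservesSectors_numberOp y 1))

end Summit.Ventures.CertifiedManyBodySolver.HubbardAlg.GSTermwisePlacement
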